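import Literature.MathematicalPhysics.StatisticalMechanics.Theil2006EnergyBounds
import HarnessLib

/-!
# Theil 2006, §4.2 (Definition 4.4, Lemma 4.6): lattice walks in `A₂`, elementary moves, and the
simple connectivity of hexagonal balls — the combinatorial kernel of the Burgers-vector argument

Topic `Literature/MathematicalPhysics/StatisticalMechanics`; companion of `Theil2006.lean`
(F. Theil, *A proof of crystallization in two dimensions*, Comm. Math. Phys. **262** (2006)
209–236, accepted preprint of 26 Aug 2005), Appendix §4.2. Everything here is PROVED; the
`def`s are plain definitions with bodies (the graph norm of `A₂`, a canonical inward step, the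
canonical outward walk, the position bookkeeping of a walk, an inductive equivalence relation).
Pure `ℤ²` combinatorics: no configuration `y` appears.

## Source, as printed (preprint pp. 19–20), and what this file is for

Definition 4.4 (discrete closed paths `γ` in a patch, their turns `r(γ(k)) ∈ {0,…,5}` and the
Burgers vector (59) `b(γ, v) = Σ_k R^{Σ_{j<k} r(γ(j))} v`); Remark 4.5; Lemma 4.6: "Let
`Ω(γ) ∩ y(∂X) = ∅`. Then the Burgers vector `b(γ) = 0` for every discrete and simple closed
path `γ ∈ (y⁻¹(Ω(γ)))^{K(γ)}`", proved by induction on the area `vol(Ω(γ)) ∈ ¼ℕ`, using the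
Jordan curve `∂Ω(γ)`. The role of Lemma 4.6 in the proof of Proposition 4.8 (p. 21) is to make
the path sums (64) `Φ(x) = Σ_k R^{Σ_{j<k} r(γ_x(j))} e₁` independent of the path `γ_x`.

This file proves the PATH-INDEPENDENCE INPUT in the flat model, where it is pure combinatorics:
in the triangular lattice (labels `ℤ²`, unit steps `unitShell`), any closed walk that stays in a
hexagonal ball `{η : hexNorm(η − c) ≤ n}` can be reduced to the empty walk by ELEMENTARY MOVES
— deleting/inserting a backtrack `u, −u`, and replacing a step `u` by two steps `v, w` with
`v + w = u` (the other two sides of a unit triangle) or conversely — through walks that all stay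
in the same ball (`Theil2006.WalkEquiv.nil_of_closed`), and whose lengths stay below an
explicit bound `L` (the third index of `WalkEquiv`; `L = length + 2n + 2` suffices). Equivalently,
two walks in the ball with the same endpoints are move-equivalent (`WalkEquiv.of_sum_eq`). A quantity attached to walks that
is invariant under the two elementary moves (among walks of length `≤ L`) is therefore a
function of the endpoint alone (`WalkEquiv.invariant`) — this
is how discrete imbeddings are continued along walks without monodromy (the use made of Lemma 4.6
on p. 21), with the simple connectivity supplied by the LABEL ball instead of by a Jordan domain
`Ω(γ) ⊂ ℝ²`. [cite: Theil2006, §4.2 Definition 4.4, Lemma 4.6 and proof of Proposition 4.8 (64)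
(preprint pp. 19–21); our combinatorial form]

Proof: every walk from `g` inside the ball is move-equivalent to the canonical walk "inwards from
`g` to the centre `c`, then outwards to the endpoint" (`WalkEquiv.canonical`), by induction on
the length, using a local confluence lemma for the canonical outward walks (`outWalk_confluence`:
`out(b′) ++ [b − b′] ∼ out(b)` for adjacent `b′, b`, by induction on the layer of `b`, three
cases: `b′` one layer in, in the same layer, one layer out); the lattice facts used (the inward
step lowers the graph norm by one; two inner neighbours of a point are adjacent; adjacent points
of the same layer have a common inner neighbour) are linear integer arithmetic (`omega`).
-/

namespace Literature.MathematicalPhysics.StatisticalMechanics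

namespace Theil2006

/-! ### The graph norm of `A₂` and the canonical inward step -/

section HexNorm

/-- The graph norm of a label `v = (a, b)` in the triangular lattice with steps `unitShell`:
`max(|a|, |b|, |a + b|)` (the number of unit steps needed to reach `v` from `0`).
[cite: Theil2006, §4.2 proof of Proposition 4.8 (3) (62) («`B(Φ(x), ½r) ∩ A₂`», preprint p. 21); our bookkeeping] -/
def hexNorm (v : ℤ × ℤ) : ℕ := max (max v.1.natAbs v.2.natAbs) (v.1 + v.2).natAbs

/-- The six unit steps, as explicit alternatives. [cite: Theil2006, §2.3 Remark 2.5 («#{η′ ∈ A₂ | |η − η′| ∈ (0,1]} = 6», preprint p. 7)] -/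
theorem mem_unitShell_iff' (u : ℤ × ℤ) : u ∈ unitShell ↔
    u = (1, 0) ∨ u = (0, 1) ∨ u = (-1, 0) ∨ u = (0, -1) ∨ u = (1, -1) ∨ u = (-1, 1) := by
  simp [unitShell]

/-- Only the origin has graph norm `0`. [cite: Theil2006, §4.2 proof of Proposition 4.8 (3) (62) (graph distance in A₂, preprint p. 21); our bookkeeping] -/
theorem hexNorm_eq_zero_iff (v : ℤ × ℤ) : hexNorm v = 0 ↔ v = 0 := by
  constructor
  · intro h
    unfold hexNorm at h
    ext <;> simp <;> omega
  · rintro rfl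
    simp [hexNorm]

/-- The graph norm as six linear inequalities (`omega`-friendly form). [cite: Theil2006, §4.2 proof of Proposition 4.8 (3) (62) (graph distance in A₂, preprint p. 21); our bookkeeping] -/
theorem hexNorm_le_iff (v : ℤ × ℤ) (n : ℕ) : hexNorm v ≤ n ↔
    v.1 ≤ n ∧ -v.1 ≤ n ∧ v.2 ≤ n ∧ -v.2 ≤ n ∧ v.1 + v.2 ≤ n ∧ -(v.1 + v.2) ≤ n := by
  unfold hexNorm
  omega

/-- A unit step changes the graph norm by at most one (upwards). [cite: Theil2006, §2.3 Remark 2.5 (preprint p. 7); our bookkeeping] -/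
theorem hexNorm_add_le_succ {u : ℤ × ℤ} (hu : u ∈ unitShell) (v : ℤ × ℤ) :
    hexNorm (v + u) ≤ hexNorm v + 1 := by
  have h := (hexNorm_le_iff v (hexNorm v)).1 le_rfl
  rw [hexNorm_le_iff]
  rw [mem_unitShell_iff'] at hu
  rcases hu with rfl | rfl | rfl | rfl | rfl | rfl <;>
    simp only [Prod.fst_add, Prod.snd_add] <;> push_cast <;> omega

/-- A unit step changes the graph norm by at most one (downwards). [cite: Theil2006, §2.3 Remark 2.5 (preprint p. 7); our bookkeeping] -/
theorem hexNorm_le_add_succ {u : ℤ × ℤ} (hu : u ∈ unitShell) (v : ℤ × ℤ) :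
    hexNorm v ≤ hexNorm (v + u) + 1 := by
  have h := (hexNorm_le_iff (v + u) (hexNorm (v + u))).1 le_rfl
  rw [hexNorm_le_iff]
  rw [mem_unitShell_iff'] at hu
  rcases hu with rfl | rfl | rfl | rfl | rfl | rfl <;>
    simp only [Prod.fst_add, Prod.snd_add] at h ⊢ <;> push_cast at h ⊢ <;> omega

/-- Unit steps are symmetric. [folklore] -/
private theorem neg_mem_unitShell' {u : ℤ × ℤ} (hu : u ∈ unitShell) : -u ∈ unitShell := by
  rw [mem_unitShell_iff'] at hu ⊢
  rcases hu with rfl | rfl | rfl | rfl | rfl | rfl <;> simp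

/-- **The canonical inward step**: for `v ≠ 0`, a unit step `σ(v)` with
`hexNorm(v − σ(v)) = hexNorm(v) − 1` (one sector of the hexagon at a time). [cite: Theil2006, §4.2 proof of Proposition 4.8 (3) (62) (preprint p. 21); our bookkeeping] -/
def inStep (v : ℤ × ℤ) : ℤ × ℤ :=
  if 1 ≤ v.1 ∧ 0 ≤ v.2 then (1, 0)
  else if 1 ≤ v.1 then (1, -1)
  else if v.1 = 0 ∧ 1 ≤ v.2 then (0, 1)
  else if 1 ≤ v.2 then (-1, 1)
  else if v.1 ≤ -1 then (-1, 0)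
  else (0, -1)

/-- The inward step is a unit step. [folklore] -/
private theorem inStep_mem_unitShell (v : ℤ × ℤ) : inStep v ∈ unitShell := by
  unfold inStep
  split_ifs <;> simp [unitShell]

/-- The inward step lowers the graph norm by one: from layer `≤ k + 1` to layer `≤ k`
(`v ≠ 0`). [folklore] -/
private theorem hexNorm_sub_inStep_le {v : ℤ × ℤ} (hv : v ≠ 0) {k : ℕ} (h : hexNorm v ≤ k + 1) :
    hexNorm (v - inStep v) ≤ k := by
  have hv' : v.1 ≠ 0 ∨ v.2 ≠ 0 := by
    by_contra h0
    push Not at h0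
    exact hv (Prod.ext h0.1 h0.2)
  rw [hexNorm_le_iff] at h ⊢
  unfold inStep
  split_ifs <;> simp only [Prod.fst_sub, Prod.snd_sub] <;> omega

/-- The inward step strictly lowers the graph norm (`v ≠ 0`). [folklore] -/
private theorem hexNorm_sub_inStep_lt {v : ℤ × ℤ} (hv : v ≠ 0) : hexNorm (v - inStep v) < hexNorm v := by
  have h1 : hexNorm v ≠ 0 := fun h0 => hv ((hexNorm_eq_zero_iff v).1 h0)
  obtain ⟨k, hk⟩ := Nat.exists_eq_succ_of_ne_zero h1
  have := hexNorm_sub_inStep_le hv (k := k) (by rw [hk])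
  omega

/-- **Two inner neighbours of a label are adjacent**: if `v` lies in layer `k + 1` and both
`v − u`, `v − u′` (`u ≠ u′` unit steps) lie in layer `≤ k`, then `u − u′` is a unit step.
[folklore] -/
private theorem sub_mem_unitShell_of_inner {v u u' : ℤ × ℤ} {k : ℕ} (hu : u ∈ unitShell)
    (hu' : u' ∈ unitShell) (hne : u ≠ u') (hv : ¬ hexNorm v ≤ k)
    (h : hexNorm (v - u) ≤ k) (h' : hexNorm (v - u') ≤ k) : u - u' ∈ unitShell := by
  rw [hexNorm_le_iff] at hv h h'
  rw [mem_unitShell_iff'] at hu hu'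
  rcases hu with rfl | rfl | rfl | rfl | rfl | rfl <;>
    rcases hu' with rfl | rfl | rfl | rfl | rfl | rfl <;>
    first
    | exact absurd rfl hne
    | (simp only [Prod.fst_sub, Prod.snd_sub, Prod.mk_sub_mk] at h h' ⊢
       first
       | (simp [unitShell]; done)
       | (exfalso; omega))

/-- **Adjacent labels of the same layer have a common neighbour one layer in**: if `v` and
`v + u` both lie in layer `k + 1` (`u` a unit step), there is a unit step `w` with `u − w` a unit
step and `v + w` in layer `≤ k`. [folklore] -/
private theorem exists_common_inner {v u : ℤ × ℤ} {k : ℕ} (hu : u ∈ unitShell)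
    (hv : ¬ hexNorm v ≤ k) (hv1 : hexNorm v ≤ k + 1)
    (hvu : ¬ hexNorm (v + u) ≤ k) (hvu1 : hexNorm (v + u) ≤ k + 1) :
    ∃ w ∈ unitShell, u - w ∈ unitShell ∧ hexNorm (v + w) ≤ k := by
  rw [hexNorm_le_iff] at hv hv1 hvu hvu1
  rw [mem_unitShell_iff'] at hu
  rcases hu with rfl | rfl | rfl | rfl | rfl | rfl <;>
    simp only [Prod.fst_add, Prod.snd_add] at hvu hvu1
  · -- u = (1, 0): w ∈ {(0, 1), (1, -1)}
    by_cases hw : hexNorm (v + (0, 1)) ≤ k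
    · exact ⟨(0, 1), by simp [unitShell], by simp [unitShell], hw⟩
    · refine ⟨(1, -1), by simp [unitShell], by simp [unitShell], ?_⟩
      rw [hexNorm_le_iff] at hw ⊢
      simp only [Prod.fst_add, Prod.snd_add] at hw ⊢
      omega
  · -- u = (0, 1): w ∈ {(1, 0), (-1, 1)}
    by_cases hw : hexNorm (v + (1, 0)) ≤ k
    · exact ⟨(1, 0), by simp [unitShell], by simp [unitShell], hw⟩
    · refine ⟨(-1, 1), by simp [unitShell], by simp [unitShell], ?_⟩
      rw [hexNorm_le_iff] at hw ⊢
      simp only [Prod.fst_add, Prod.snd_add] at hw ⊢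
      omega
  · -- u = (-1, 0): w ∈ {(0, -1), (-1, 1)}
    by_cases hw : hexNorm (v + (0, -1)) ≤ k
    · exact ⟨(0, -1), by simp [unitShell], by simp [unitShell], hw⟩
    · refine ⟨(-1, 1), by simp [unitShell], by simp [unitShell], ?_⟩
      rw [hexNorm_le_iff] at hw ⊢
      simp only [Prod.fst_add, Prod.snd_add] at hw ⊢
      omega
  · -- u = (0, -1): w ∈ {(1, -1), (-1, 0)}
    by_cases hw : hexNorm (v + (1, -1)) ≤ k
    · exact ⟨(1, -1), by simp [unitShell], by simp [unitShell], hw⟩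
    · refine ⟨(-1, 0), by simp [unitShell], by simp [unitShell], ?_⟩
      rw [hexNorm_le_iff] at hw ⊢
      simp only [Prod.fst_add, Prod.snd_add] at hw ⊢
      omega
  · -- u = (1, -1): w ∈ {(1, 0), (0, -1)}
    by_cases hw : hexNorm (v + (1, 0)) ≤ k
    · exact ⟨(1, 0), by simp [unitShell], by simp [unitShell], hw⟩
    · refine ⟨(0, -1), by simp [unitShell], by simp [unitShell], ?_⟩
      rw [hexNorm_le_iff] at hw ⊢
      simp only [Prod.fst_add, Prod.snd_add] at hw ⊢
      omega
  · -- u = (-1, 1): w ∈ {(-1, 0), (0, 1)}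
    by_cases hw : hexNorm (v + (-1, 0)) ≤ k
    · exact ⟨(-1, 0), by simp [unitShell], by simp [unitShell], hw⟩
    · refine ⟨(0, 1), by simp [unitShell], by simp [unitShell], ?_⟩
      rw [hexNorm_le_iff] at hw ⊢
      simp only [Prod.fst_add, Prod.snd_add] at hw ⊢
      omega

end HexNorm

/-! ### Walks, their positions, and the elementary moves -/

section Walks

/-- A list of steps is a lattice walk if every step is a unit step.
[cite: Theil2006, §4.2 Definition 4.4 («{γ(k−1), γ(k)} ∈ 𝒮(y)», preprint p. 19); flat model] -/
def IsWalk (l : List (ℤ × ℤ)) : Prop := ∀ u ∈ l, u ∈ unitShell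

/-- `InBall c n g l`: every position of the walk with steps `l` started at `g` (including `g`
and the endpoint) has graph distance `≤ n` from `c`. [cite: Theil2006, §4.2 Definition 4.4 (preprint p. 19); flat model] -/
def InBall (c : ℤ × ℤ) (n : ℕ) : ℤ × ℤ → List (ℤ × ℤ) → Prop
  | g, [] => hexNorm (g - c) ≤ n
  | g, u :: l => hexNorm (g - c) ≤ n ∧ InBall c n (g + u) l

variable {c : ℤ × ℤ} {n : ℕ}

/-- Unfolding `InBall` on the empty walk. [cite: Theil2006, §4.2 Definition 4.4 (preprint p. 19); flat model, our bookkeeping] -/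
theorem inBall_nil {g : ℤ × ℤ} : InBall c n g [] ↔ hexNorm (g - c) ≤ n := Iff.rfl

/-- Unfolding `InBall` on a first step. [cite: Theil2006, §4.2 Definition 4.4 (preprint p. 19); flat model, our bookkeeping] -/
theorem inBall_cons {g u : ℤ × ℤ} {l : List (ℤ × ℤ)} :
    InBall c n g (u :: l) ↔ hexNorm (g - c) ≤ n ∧ InBall c n (g + u) l := Iff.rfl

/-- The starting point of a walk in the ball is in the ball. [cite: Theil2006, §4.2 Definition 4.4 (preprint p. 19); flat model, our bookkeeping] -/
theorem InBall.start {g : ℤ × ℤ} {l : List (ℤ × ℤ)} (h : InBall c n g l) : hexNorm (g - c) ≤ n := by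
  cases l with
  | nil => exact h
  | cons u l => exact h.1

/-- Concatenated walks: in the ball iff both pieces are (the second started at the end of the
first). [cite: Theil2006, §4.2 Definition 4.4 (preprint p. 19); flat model, our bookkeeping] -/
theorem inBall_append {g : ℤ × ℤ} {l s : List (ℤ × ℤ)} :
    InBall c n g (l ++ s) ↔ InBall c n g l ∧ InBall c n (g + l.sum) s := by
  induction l generalizing g with
  | nil =>
    simp only [List.nil_append, inBall_nil, List.sum_nil, add_zero]
    exact ⟨fun h => ⟨h.start, h⟩, fun h => h.2⟩
  | cons u l ih =>
    simp only [List.cons_append, inBall_cons, ih, List.sum_cons, add_assoc]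
    tauto

/-- The endpoint of a walk in the ball is in the ball. [cite: Theil2006, §4.2 Definition 4.4 (preprint p. 19); flat model, our bookkeeping] -/
theorem InBall.last {g : ℤ × ℤ} {l : List (ℤ × ℤ)} (h : InBall c n g l) :
    hexNorm (g + l.sum - c) ≤ n := by
  have h' : InBall c n g (l ++ []) := by rwa [List.append_nil]
  exact (inBall_append.1 h').2

/-- Concatenated walks are walks iff both pieces are. [cite: Theil2006, §4.2 Definition 4.4 (preprint p. 19); flat model, our bookkeeping] -/
theorem isWalk_append {l s : List (ℤ × ℤ)} : IsWalk (l ++ s) ↔ IsWalk l ∧ IsWalk s := by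
  simp only [IsWalk, List.mem_append]
  exact ⟨fun h => ⟨fun u hu => h u (Or.inl hu), fun u hu => h u (Or.inr hu)⟩,
    fun h u hu => hu.elim (h.1 u) (h.2 u)⟩

/-- A step list with its steps drawn from `unitShell`, after a cons. [cite: Theil2006, §4.2 Definition 4.4 (preprint p. 19); flat model, our bookkeeping] -/
theorem isWalk_cons {u : ℤ × ℤ} {l : List (ℤ × ℤ)} : IsWalk (u :: l) ↔ u ∈ unitShell ∧ IsWalk l := by
  simp only [IsWalk, List.mem_cons, forall_eq_or_imp]

/-- The empty walk is a walk. [cite: Theil2006, §4.2 Definition 4.4 (preprint p. 19); flat model, our bookkeeping] -/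
theorem isWalk_nil : IsWalk ([] : List (ℤ × ℤ)) := fun _ h => by simp at h

/-- The reversed walk (steps negated, order reversed). [cite: Theil2006, §4.2 Definition 4.4 (preprint p. 19); flat model] -/
def revNeg (l : List (ℤ × ℤ)) : List (ℤ × ℤ) := (l.map Neg.neg).reverse

/-- Unfolding `revNeg` on a cons. [cite: Theil2006, §4.2 Definition 4.4 (preprint p. 19); flat model, our bookkeeping] -/
theorem revNeg_cons (u : ℤ × ℤ) (l : List (ℤ × ℤ)) : revNeg (u :: l) = revNeg l ++ [-u] := by
  simp [revNeg]

/-- `revNeg [] = []`. [cite: Theil2006, §4.2 Definition 4.4 (preprint p. 19); flat model, our bookkeeping] -/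
theorem revNeg_nil : revNeg ([] : List (ℤ × ℤ)) = [] := rfl

/-- The reversed walk is a walk. [cite: Theil2006, §4.2 Definition 4.4 (preprint p. 19); flat model, our bookkeeping] -/
theorem isWalk_revNeg {l : List (ℤ × ℤ)} (h : IsWalk l) : IsWalk (revNeg l) := by
  intro u hu
  simp only [revNeg, List.mem_reverse, List.mem_map] at hu
  obtain ⟨v, hv, rfl⟩ := hu
  exact neg_mem_unitShell' (h v hv)

/-- Reversal preserves the length of a walk. [cite: Theil2006, §4.2 Definition 4.4 (preprint p. 19); flat model, our bookkeeping] -/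
theorem length_revNeg (l : List (ℤ × ℤ)) : (revNeg l).length = l.length := by
  simp [revNeg]

/-- The reversed walk returns to the start: its steps sum to minus the original sum. [cite: Theil2006, §4.2 Definition 4.4 (preprint p. 19); flat model, our bookkeeping] -/
theorem sum_revNeg (l : List (ℤ × ℤ)) : (revNeg l).sum = -l.sum := by
  induction l with
  | nil => simp [revNeg]
  | cons u l ih =>
    rw [revNeg_cons, List.sum_append, ih, List.sum_cons, List.sum_cons, List.sum_nil]
    abel

/-- The reversed walk, started at the endpoint, stays in the ball. [cite: Theil2006, §4.2 Definition 4.4 (preprint p. 19); flat model, our bookkeeping] -/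
theorem inBall_revNeg {a : ℤ × ℤ} {l : List (ℤ × ℤ)} (h : InBall c n a l) :
    InBall c n (a + l.sum) (revNeg l) := by
  induction l generalizing a with
  | nil => simpa [revNeg] using h
  | cons u l ih =>
    rw [inBall_cons] at h
    rw [revNeg_cons, inBall_append, List.sum_cons, ← add_assoc]
    refine ⟨ih h.2, ?_⟩
    rw [sum_revNeg, inBall_cons, inBall_nil]
    constructor
    · have := (ih h.2).start
      convert h.2.start using 2
      abel
    · convert h.1 using 2
      abel

/-- A lattice walk of length `k` ends within graph distance `k` of its start. [cite: Theil2006, §4.2 Definition 4.4 (preprint p. 19); flat model, our bookkeeping] -/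
theorem hexNorm_sum_le_length {l : List (ℤ × ℤ)} (hl : IsWalk l) : hexNorm l.sum ≤ l.length := by
  induction l with
  | nil => simp [hexNorm]
  | cons u l ih =>
    rw [isWalk_cons] at hl
    rw [List.sum_cons, List.length_cons, add_comm u]
    exact (hexNorm_add_le_succ hl.1 _).trans (by have := ih hl.2; omega)

/-- A lattice walk of length `≤ n` started at the centre stays in the ball of radius `n`.
[cite: Theil2006, §4.2 Definition 4.4 (preprint p. 19); flat model, our bookkeeping] -/
theorem inBall_of_length_le {l : List (ℤ × ℤ)} (hl : IsWalk l) (hn : l.length ≤ n) :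
    InBall c n c l := by
  induction l using List.reverseRecOn with
  | nil => rw [inBall_nil, sub_self]; simp [hexNorm]
  | append_singleton l u ih =>
    rw [isWalk_append] at hl
    rw [List.length_append, List.length_singleton] at hn
    rw [inBall_append, inBall_cons, inBall_nil]
    refine ⟨ih hl.1 (by omega), ?_, ?_⟩
    · rw [add_sub_cancel_left]
      exact (hexNorm_sum_le_length hl.1).trans (by omega)
    · rw [add_assoc, add_sub_cancel_left]
      have : IsWalk (l ++ [u]) := isWalk_append.2 hl
      have h := hexNorm_sum_le_length this
      rw [List.sum_append, List.sum_cons, List.sum_nil, add_zero, List.length_append,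
        List.length_singleton] at h
      omega

/-- **Move-equivalence of walks in the ball `{hexNorm(· − c) ≤ n}` started at `g`, through
walks of length at most `L`**: the equivalence relation generated by the two elementary moves —
deleting a backtrack `u, −u`, and replacing a step `u` by the two other sides `v, w` (`v + w = u`)
of a unit triangle — performed anywhere inside a walk, all walks involved being lattice walks
inside the ball, the longer walk of each move having length `≤ L` (so that a move-invariant needs
to be checked on walks of bounded length only, `WalkEquiv.invariant`).
[cite: Theil2006, §4.2 Definition 4.4 and Lemma 4.6 (preprint pp. 19–20); our combinatorial form] -/
inductive WalkEquiv (c : ℤ × ℤ) (n L : ℕ) (g : ℤ × ℤ) : List (ℤ × ℤ) → List (ℤ × ℤ) → Prop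
  | refl {l : List (ℤ × ℤ)} : IsWalk l → InBall c n g l → WalkEquiv c n L g l l
  | symm {l l' : List (ℤ × ℤ)} : WalkEquiv c n L g l l' → WalkEquiv c n L g l' l
  | trans {l l' l'' : List (ℤ × ℤ)} :
      WalkEquiv c n L g l l' → WalkEquiv c n L g l' l'' → WalkEquiv c n L g l l''
  | backtrack {l₁ l₂ : List (ℤ × ℤ)} {u : ℤ × ℤ} : u ∈ unitShell → IsWalk l₁ → IsWalk l₂ →
      InBall c n g (l₁ ++ u :: -u :: l₂) → (l₁ ++ u :: -u :: l₂).length ≤ L →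
      WalkEquiv c n L g (l₁ ++ u :: -u :: l₂) (l₁ ++ l₂)
  | triangle {l₁ l₂ : List (ℤ × ℤ)} {u v w : ℤ × ℤ} : u ∈ unitShell → v ∈ unitShell →
      w ∈ unitShell → v + w = u → IsWalk l₁ → IsWalk l₂ → InBall c n g (l₁ ++ u :: l₂) →
      InBall c n g (l₁ ++ v :: w :: l₂) → (l₁ ++ v :: w :: l₂).length ≤ L →
      WalkEquiv c n L g (l₁ ++ u :: l₂) (l₁ ++ v :: w :: l₂)

variable {L : ℕ} {g : ℤ × ℤ}

/-- Raising the length bound. [cite: Theil2006, §4.2 Lemma 4.6 (preprint p. 20); our combinatorial form] -/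
theorem WalkEquiv.mono {L' : ℕ} {l l' : List (ℤ × ℤ)} (h : WalkEquiv c n L g l l') (hL : L ≤ L') :
    WalkEquiv c n L' g l l' := by
  induction h with
  | refl hw hb => exact WalkEquiv.refl hw hb
  | symm _ ih => exact ih.symm
  | trans _ _ ih1 ih2 => exact ih1.trans ih2
  | backtrack hu h1 h2 hb hlen => exact WalkEquiv.backtrack hu h1 h2 hb (hlen.trans hL)
  | triangle hu hv hw hvw h1 h2 hb hb' hlen =>
    exact WalkEquiv.triangle hu hv hw hvw h1 h2 hb hb' (hlen.trans hL)

/-- Move-equivalent walks are walks in the ball with the same endpoint. [cite: Theil2006, §4.2 Lemma 4.6 (preprint p. 20); our combinatorial form] -/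
theorem WalkEquiv.wf {l l' : List (ℤ × ℤ)} (h : WalkEquiv c n L g l l') :
    IsWalk l ∧ IsWalk l' ∧ InBall c n g l ∧ InBall c n g l' ∧ l.sum = l'.sum := by
  induction h with
  | refl hw hb => exact ⟨hw, hw, hb, hb, rfl⟩
  | symm _ ih => exact ⟨ih.2.1, ih.1, ih.2.2.2.1, ih.2.2.1, ih.2.2.2.2.symm⟩
  | trans _ _ ih1 ih2 =>
    exact ⟨ih1.1, ih2.2.1, ih1.2.2.1, ih2.2.2.2.1, ih1.2.2.2.2.trans ih2.2.2.2.2⟩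
  | @backtrack l₁ l₂ u hu h1 h2 hb _ =>
    have hsum : (l₁ ++ u :: -u :: l₂).sum = (l₁ ++ l₂).sum := by
      simp only [List.sum_append, List.sum_cons]; abel
    refine ⟨?_, isWalk_append.2 ⟨h1, h2⟩, hb, ?_, hsum⟩
    · exact isWalk_append.2 ⟨h1, isWalk_cons.2 ⟨hu, isWalk_cons.2 ⟨neg_mem_unitShell' hu, h2⟩⟩⟩
    · rw [inBall_append] at hb ⊢
      refine ⟨hb.1, ?_⟩
      have h3 := hb.2
      rw [inBall_cons, inBall_cons] at h3
      have e : g + l₁.sum + u + -u = g + (l₁ ++ l₂).sum - l₂.sum := by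
        rw [List.sum_append]; abel
      have e' : g + l₁.sum = g + (l₁ ++ l₂).sum - l₂.sum := by
        rw [List.sum_append]; abel
      rw [e] at h3
      rw [e']
      exact h3.2.2
  | @triangle l₁ l₂ u v w hu hv hw hvw h1 h2 hb hb' _ =>
    have hsum : (l₁ ++ u :: l₂).sum = (l₁ ++ v :: w :: l₂).sum := by
      simp only [List.sum_append, List.sum_cons, ← hvw]; abel
    exact ⟨isWalk_append.2 ⟨h1, isWalk_cons.2 ⟨hu, h2⟩⟩,
      isWalk_append.2 ⟨h1, isWalk_cons.2 ⟨hv, isWalk_cons.2 ⟨hw, h2⟩⟩⟩, hb, hb', hsum⟩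

/-- Appending a common tail (inside the ball) preserves move-equivalence. [cite: Theil2006, §4.2 Lemma 4.6 (preprint p. 20); our combinatorial form] -/
theorem WalkEquiv.append_right {l l' s : List (ℤ × ℤ)} (h : WalkEquiv c n L g l l')
    (hs : IsWalk s) (hbs : InBall c n (g + l.sum) s) :
    WalkEquiv c n (L + s.length) g (l ++ s) (l' ++ s) := by
  induction h with
  | refl hw hb => exact WalkEquiv.refl (isWalk_append.2 ⟨hw, hs⟩) (inBall_append.2 ⟨hb, hbs⟩)
  | symm h ih =>
    have := h.wf.2.2.2.2
    exact (ih (by rwa [this])).symm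
  | trans h1 h2 ih1 ih2 =>
    have := h1.wf.2.2.2.2
    exact (ih1 hbs).trans (ih2 (by rwa [← this]))
  | @backtrack l₁ l₂ u hu h1 h2 hb hlen =>
    have e1 : l₁ ++ u :: -u :: l₂ ++ s = l₁ ++ u :: -u :: (l₂ ++ s) := by simp
    have e2 : l₁ ++ l₂ ++ s = l₁ ++ (l₂ ++ s) := by simp
    rw [e1, e2]
    refine WalkEquiv.backtrack hu h1 (isWalk_append.2 ⟨h2, hs⟩) ?_ ?_
    · rw [← e1]
      exact inBall_append.2 ⟨hb, hbs⟩
    · rw [← e1, List.length_append]; omega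
  | @triangle l₁ l₂ u v w hu hv hw hvw h1 h2 hb hb' hlen =>
    have e1 : l₁ ++ u :: l₂ ++ s = l₁ ++ u :: (l₂ ++ s) := by simp
    have e2 : l₁ ++ v :: w :: l₂ ++ s = l₁ ++ v :: w :: (l₂ ++ s) := by simp
    rw [e1, e2]
    refine WalkEquiv.triangle hu hv hw hvw h1 (isWalk_append.2 ⟨h2, hs⟩) ?_ ?_ ?_
    · rw [← e1]; exact inBall_append.2 ⟨hb, hbs⟩
    · rw [← e2]
      refine inBall_append.2 ⟨hb', ?_⟩
      have hsum : (l₁ ++ u :: l₂).sum = (l₁ ++ v :: w :: l₂).sum := by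
        simp only [List.sum_append, List.sum_cons, ← hvw]; abel
      rwa [← hsum]
    · rw [← e2, List.length_append]; omega

/-- Prepending a common head (a walk from `g` inside the ball) preserves move-equivalence.
[cite: Theil2006, §4.2 Lemma 4.6 (preprint p. 20); our combinatorial form] -/
theorem WalkEquiv.append_left {p l l' : List (ℤ × ℤ)} (h : WalkEquiv c n L (g + p.sum) l l')
    (hp : IsWalk p) (hbp : InBall c n g p) :
    WalkEquiv c n (L + p.length) g (p ++ l) (p ++ l') := by
  induction h with
  | refl hw hb => exact WalkEquiv.refl (isWalk_append.2 ⟨hp, hw⟩) (inBall_append.2 ⟨hbp, hb⟩)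
  | symm _ ih => exact ih.symm
  | trans _ _ ih1 ih2 => exact ih1.trans ih2
  | @backtrack l₁ l₂ u hu h1 h2 hb hlen =>
    have e1 : p ++ (l₁ ++ u :: -u :: l₂) = (p ++ l₁) ++ u :: -u :: l₂ := by simp
    have e2 : p ++ (l₁ ++ l₂) = (p ++ l₁) ++ l₂ := by simp
    rw [e1, e2]
    refine WalkEquiv.backtrack hu (isWalk_append.2 ⟨hp, h1⟩) h2 ?_ ?_
    · rw [← e1]
      exact inBall_append.2 ⟨hbp, hb⟩
    · rw [← e1, List.length_append]; omega
  | @triangle l₁ l₂ u v w hu hv hw hvw h1 h2 hb hb' hlen =>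
    have e1 : p ++ (l₁ ++ u :: l₂) = (p ++ l₁) ++ u :: l₂ := by simp
    have e2 : p ++ (l₁ ++ v :: w :: l₂) = (p ++ l₁) ++ v :: w :: l₂ := by simp
    rw [e1, e2]
    refine WalkEquiv.triangle hu hv hw hvw (isWalk_append.2 ⟨hp, h1⟩) h2 ?_ ?_ ?_
    · rw [← e1]; exact inBall_append.2 ⟨hbp, hb⟩
    · rw [← e2]; exact inBall_append.2 ⟨hbp, hb'⟩
    · rw [← e2, List.length_append]; omega

/-- A walk followed by its own reversal is move-equivalent to the empty walk (backtracks removed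
innermost first). [cite: Theil2006, §4.2 Lemma 4.6 (preprint p. 20); our combinatorial form] -/
theorem WalkEquiv.revNeg_append_self {a : ℤ × ℤ} {l : List (ℤ × ℤ)} (hl : IsWalk l)
    (hb : InBall c n a l) : WalkEquiv c n (2 * l.length) (a + l.sum) (revNeg l ++ l) [] := by
  induction l generalizing a with
  | nil =>
    simp only [revNeg_nil, List.append_nil, List.sum_nil, add_zero]
    exact WalkEquiv.refl isWalk_nil hb
  | cons u l ih =>
    rw [isWalk_cons] at hl
    rw [inBall_cons] at hb
    have e : revNeg (u :: l) ++ u :: l = revNeg l ++ (-u) :: -(-u) :: l := by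
      rw [revNeg_cons, neg_neg]; simp
    have hstart : a + (u :: l).sum = (a + u) + l.sum := by rw [List.sum_cons, add_assoc]
    rw [e, hstart]
    refine WalkEquiv.trans ?_ ((ih hl.2 hb.2).mono (by simp))
    refine WalkEquiv.backtrack (neg_mem_unitShell' hl.1) (isWalk_revNeg hl.2) hl.2 ?_ ?_
    · rw [inBall_append]
      refine ⟨inBall_revNeg hb.2, ?_⟩
      rw [sum_revNeg, inBall_cons, inBall_cons, neg_neg]
      refine ⟨?_, ?_, ?_⟩
      · convert hb.2.start using 2; abel
      · convert hb.1 using 2; abel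
      · convert hb.2 using 2; abel
    · simp only [List.length_append, length_revNeg, List.length_cons]; omega

end Walks

/-! ### The canonical outward walk and its local confluence -/

section Canonical

variable {c : ℤ × ℤ} {n : ℕ}

/-- The inward step strictly lowers the distance to the centre. [folklore] -/
private theorem hexNorm_pred_lt {c b : ℤ × ℤ} (h : b ≠ c) :
    hexNorm (b - inStep (b - c) - c) < hexNorm (b - c) := by
  have e : b - inStep (b - c) - c = (b - c) - inStep (b - c) := by abel
  rw [e]
  exact hexNorm_sub_inStep_lt (sub_ne_zero.2 h)

/-- **The canonical outward walk** from the centre `c` to `b`: the canonical inward walk from `b`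
(iterating `inStep`), reversed. [cite: Theil2006, §4.2 proof of Proposition 4.8 (3) (62) (preprint p. 21); our bookkeeping] -/
def outWalk (c : ℤ × ℤ) (b : ℤ × ℤ) : List (ℤ × ℤ) :=
  if _h : b = c then [] else outWalk c (b - inStep (b - c)) ++ [inStep (b - c)]
termination_by hexNorm (b - c)
decreasing_by exact hexNorm_pred_lt _h

/-- The canonical walk to the centre itself is empty. [folklore] -/
private theorem outWalk_self (c : ℤ × ℤ) : outWalk c c = [] := by
  rw [outWalk]; simp

/-- Unfolding the canonical walk one step. [folklore] -/
private theorem outWalk_eq {c b : ℤ × ℤ} (h : b ≠ c) :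
    outWalk c b = outWalk c (b - inStep (b - c)) ++ [inStep (b - c)] := by
  rw [outWalk]; simp [h]

/-- The canonical outward walk is a lattice walk from `c` to `b` inside every ball around `c`
containing `b`. [cite: Theil2006, §4.2 proof of Proposition 4.8 (3) (62) (preprint p. 21); our bookkeeping] -/
theorem outWalk_spec (c b : ℤ × ℤ) : IsWalk (outWalk c b) ∧ (outWalk c b).sum = b - c ∧
    ∀ n : ℕ, hexNorm (b - c) ≤ n → InBall c n c (outWalk c b) := by
  induction hm : hexNorm (b - c) using Nat.strong_induction_on generalizing b with
  | _ m ih =>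
    by_cases h : b = c
    · subst h
      rw [outWalk_self]
      refine ⟨isWalk_nil, by simp, fun n _ => ?_⟩
      rw [inBall_nil, sub_self]
      simp [hexNorm]
    · rw [outWalk_eq h]
      have hlt := hexNorm_pred_lt h
      rw [hm] at hlt
      obtain ⟨hw, hs, hb⟩ := ih _ hlt (b - inStep (b - c)) rfl
      refine ⟨isWalk_append.2 ⟨hw, isWalk_cons.2 ⟨inStep_mem_unitShell _, isWalk_nil⟩⟩, ?_,
        fun n hn => ?_⟩
      · rw [List.sum_append, hs, List.sum_cons, List.sum_nil]; abel
      · rw [inBall_append, hs, inBall_cons, inBall_nil]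
        have hpred : hexNorm (b - inStep (b - c) - c) ≤ n := (hlt.trans_le (hm ▸ hn)).le
        refine ⟨hb n hpred, ?_, ?_⟩
        · convert hpred using 2; abel
        · have e : c + (b - inStep (b - c) - c) + inStep (b - c) - c = b - c := by abel
          rw [e, hm]; exact hn

/-- The canonical outward walk to `b` has length `hexNorm(b − c)` (it is a geodesic).
[cite: Theil2006, §4.2 proof of Proposition 4.8 (3) (62) (preprint p. 21); our bookkeeping] -/
theorem length_outWalk (c b : ℤ × ℤ) : (outWalk c b).length = hexNorm (b - c) := by
  induction hm : hexNorm (b - c) using Nat.strong_induction_on generalizing b with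
  | _ m ih =>
    by_cases h : b = c
    · subst h
      have h0 : m = 0 := by rw [← hm, sub_self]; simp [hexNorm]
      rw [outWalk_self, h0, List.length_nil]
    · rw [outWalk_eq h, List.length_append, List.length_singleton]
      have hlt := hexNorm_pred_lt h
      obtain ⟨k, hk⟩ : ∃ k, hexNorm (b - c) = k + 1 :=
        Nat.exists_eq_succ_of_ne_zero fun h0 => h (sub_eq_zero.1 ((hexNorm_eq_zero_iff _).1 h0))
      have e : b - inStep (b - c) - c = b - c - inStep (b - c) := by abel
      have hle : hexNorm (b - inStep (b - c) - c) ≤ k := by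
        rw [e]; exact hexNorm_sub_inStep_le (sub_ne_zero.2 h) (by rw [hk])
      have hge : k + 1 ≤ hexNorm (b - inStep (b - c) - c) + 1 := by
        have := hexNorm_add_le_succ (inStep_mem_unitShell (b - c)) (b - c - inStep (b - c))
        rw [sub_add_cancel, ← e] at this
        omega
      rw [ih _ (hm ▸ hlt) _ rfl]
      omega

/-- **Local confluence of the canonical walks**: for adjacent labels `b′, b` of the ball,
`out(b′) ++ [b − b′]` is move-equivalent to `out(b)`, through walks of length at most
`max(hexNorm(b − c) + 2, hexNorm(b′ − c) + 1)` (induction on `hexNorm(b − c) + hexNorm(b′ − c)`;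
cases: `b′` one layer inside `b`, in the same layer — through a common inner neighbour —, one
layer outside). [cite: Theil2006, §4.2 Lemma 4.6 (preprint p. 20); our combinatorial form] -/
theorem outWalk_confluence' {c b b' : ℤ × ℤ} {n : ℕ} (hb : hexNorm (b - c) ≤ n)
    (hb' : hexNorm (b' - c) ≤ n) (hu : b - b' ∈ unitShell) :
    WalkEquiv c n (max (hexNorm (b - c) + 2) (hexNorm (b' - c) + 1)) c
      (outWalk c b' ++ [b - b']) (outWalk c b) := by
  induction hm : hexNorm (b - c) + hexNorm (b' - c) using Nat.strong_induction_on
    generalizing b b' with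
  | _ m ih =>
    obtain ⟨hwb, hsb, hbb⟩ := outWalk_spec c b
    obtain ⟨hwb', hsb', hbb'⟩ := outWalk_spec c b'
    have hlb : (outWalk c b).length = hexNorm (b - c) := length_outWalk c b
    have hlb' : (outWalk c b').length = hexNorm (b' - c) := length_outWalk c b'
    have hbne : b ≠ b' := by
      rintro rfl; rw [sub_self] at hu; exact absurd hu (by decide)
    -- the two norms differ by at most one
    have hle1 : hexNorm (b - c) ≤ hexNorm (b' - c) + 1 := by
      have := hexNorm_add_le_succ hu (b' - c)
      convert this using 2; abel
    have hle2 : hexNorm (b' - c) ≤ hexNorm (b - c) + 1 := by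
      have := hexNorm_add_le_succ (neg_mem_unitShell' hu) (b - c)
      convert this using 2; abel
    rcases lt_trichotomy (hexNorm (b' - c)) (hexNorm (b - c)) with hlt | heq | hgt
    · -- (a) `b′` is an inner neighbour of `b`
      have hbc : b ≠ c := by
        intro h; rw [h, sub_self] at hlt; simp [hexNorm] at hlt
      obtain ⟨k, hk⟩ : ∃ k, hexNorm (b - c) = k + 1 := Nat.exists_eq_succ_of_ne_zero (by omega)
      set u₀ := inStep (b - c) with hu₀
      by_cases hpred : b - u₀ = b'
      · -- `b′ = pred b`: literally the definition
        have : b - b' = u₀ := by rw [← hpred]; abel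
        rw [this, outWalk_eq hbc, ← hu₀, hpred]
        exact WalkEquiv.refl (isWalk_append.2 ⟨hwb', isWalk_cons.2 ⟨inStep_mem_unitShell _,
          isWalk_nil⟩⟩) (by rw [← hpred, hu₀, ← outWalk_eq hbc]; exact hbb n hb)
      · -- two distinct inner neighbours `b′`, `pred b` of `b` are adjacent
        have hnot : ¬ hexNorm (b - c) ≤ k := by omega
        have hin₀ : hexNorm (b - c - u₀) ≤ k :=
          hexNorm_sub_inStep_le (sub_ne_zero.2 hbc) (by rw [hk])
        have hin : hexNorm (b - c - (b - b')) ≤ k := by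
          have : b - c - (b - b') = b' - c := by abel
          rw [this]; omega
        have hne : b - b' ≠ u₀ := by intro h; exact hpred (by rw [← h]; abel)
        have hadj : (b - b') - u₀ ∈ unitShell :=
          sub_mem_unitShell_of_inner hu (inStep_mem_unitShell _) hne hnot hin hin₀
        -- triangle move: `[b − b′] ↦ [pred b − b′, u₀]`
        have hpb : hexNorm (b - u₀ - c) ≤ k := by
          have : b - u₀ - c = b - c - u₀ := by abel
          rw [this]; exact hin₀
        have hpbn : hexNorm (b - u₀ - c) ≤ n := by omega
        have step1 : WalkEquiv c n (max (hexNorm (b - c) + 2) (hexNorm (b' - c) + 1)) c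
            (outWalk c b' ++ [b - b']) (outWalk c b' ++ [(b - b') - u₀, u₀]) := by
          have e1 : outWalk c b' ++ [b - b'] = outWalk c b' ++ (b - b') :: [] := rfl
          have e2 : outWalk c b' ++ [(b - b') - u₀, u₀] =
              outWalk c b' ++ ((b - b') - u₀) :: u₀ :: [] := rfl
          rw [e1, e2]
          refine WalkEquiv.triangle hu hadj (inStep_mem_unitShell _) (by abel) hwb' isWalk_nil
            ?_ ?_ ?_
          · rw [inBall_append, hsb', inBall_cons, inBall_nil]
            exact ⟨hbb' n hb', by convert hb' using 2; abel, by convert hb using 2; abel⟩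
          · rw [inBall_append, hsb', inBall_cons, inBall_cons, inBall_nil]
            exact ⟨hbb' n hb', by convert hb' using 2; abel, by convert hpbn using 2; abel,
              by convert hb using 2; abel⟩
          · simp only [List.length_append, List.length_cons, List.length_nil, hlb']; omega
        -- induction: `out(b′) ++ [pred b − b′] ∼ out(pred b)` (both norms smaller)
        have hrec : WalkEquiv c n (max (hexNorm (b - u₀ - c) + 2) (hexNorm (b' - c) + 1)) c
            (outWalk c b' ++ [(b - u₀) - b']) (outWalk c (b - u₀)) := by
          refine ih (hexNorm (b - u₀ - c) + hexNorm (b' - c)) ?_ hpbn hb' ?_ rfl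
          · rw [← hm]; omega
          · convert hadj using 1; abel
        have step2 : WalkEquiv c n (max (hexNorm (b - c) + 2) (hexNorm (b' - c) + 1)) c
            (outWalk c b' ++ [(b - b') - u₀, u₀]) (outWalk c (b - u₀) ++ [u₀]) := by
          have e1 : outWalk c b' ++ [(b - b') - u₀, u₀] =
              (outWalk c b' ++ [(b - u₀) - b']) ++ [u₀] := by
            rw [List.append_assoc]; congr 1; show [(b - b') - u₀, u₀] = [(b - u₀) - b'] ++ [u₀]
            simp only [List.singleton_append, List.cons.injEq, and_true]; abel
          rw [e1]
          refine (hrec.append_right (isWalk_cons.2 ⟨inStep_mem_unitShell _, isWalk_nil⟩) ?_).mono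
            ?_
          · rw [List.sum_append, hsb', List.sum_cons, List.sum_nil, add_zero, inBall_cons,
              inBall_nil]
            exact ⟨by convert hpbn using 2; abel, by convert hb using 2; abel⟩
          · simp only [List.length_cons, List.length_nil]; omega
        rw [outWalk_eq hbc, ← hu₀]
        exact step1.trans step2
    · -- (b) same layer: through a common inner neighbour
      have hbc : b' ≠ c := by
        intro h
        rw [h, sub_self] at heq
        have h0 : hexNorm (b - c) = 0 := by rw [← heq]; simp [hexNorm]
        rw [hexNorm_eq_zero_iff, sub_eq_zero] at h0
        exact hbne (h0.trans h.symm)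
      obtain ⟨k, hk⟩ : ∃ k, hexNorm (b' - c) = k + 1 :=
        Nat.exists_eq_succ_of_ne_zero fun h0 => hbc (sub_eq_zero.1 ((hexNorm_eq_zero_iff _).1 h0))
      have hv : ¬ hexNorm (b' - c) ≤ k := by omega
      have hv1 : hexNorm (b' - c) ≤ k + 1 := by omega
      have hvu : ¬ hexNorm (b' - c + (b - b')) ≤ k := by
        have : b' - c + (b - b') = b - c := by abel
        rw [this]; omega
      have hvu1 : hexNorm (b' - c + (b - b')) ≤ k + 1 := by
        have : b' - c + (b - b') = b - c := by abel
        rw [this]; omega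
      obtain ⟨w, hw, huw, hmid⟩ := exists_common_inner hu hv hv1 hvu hvu1
      obtain ⟨mid, hmid_def⟩ : ∃ mid : ℤ × ℤ, mid = b' + w := ⟨_, rfl⟩
      rw [show b' - c + w = mid - c by rw [hmid_def]; abel] at hmid
      have hmidn : hexNorm (mid - c) ≤ n := by omega
      -- triangle move `[b − b′] ↦ [w, (b − b′) − w]`
      have step1 : WalkEquiv c n (max (hexNorm (b - c) + 2) (hexNorm (b' - c) + 1)) c
          (outWalk c b' ++ [b - b']) (outWalk c b' ++ [w, (b - b') - w]) := by
        have e1 : outWalk c b' ++ [b - b'] = outWalk c b' ++ (b - b') :: [] := rfl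
        have e2 : outWalk c b' ++ [w, (b - b') - w] = outWalk c b' ++ w :: ((b - b') - w) :: [] :=
          rfl
        rw [e1, e2]
        refine WalkEquiv.triangle hu hw huw (by abel) hwb' isWalk_nil ?_ ?_ ?_
        · rw [inBall_append, hsb', inBall_cons, inBall_nil]
          exact ⟨hbb' n hb', by convert hb' using 2; abel, by convert hb using 2; abel⟩
        · rw [inBall_append, hsb', inBall_cons, inBall_cons, inBall_nil]
          exact ⟨hbb' n hb', by convert hb' using 2; abel,
            by convert hmidn using 2; rw [hmid_def]; abel, by convert hb using 2; abel⟩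
        · simp only [List.length_append, List.length_cons, List.length_nil, hlb']; omega
      -- `out(b′) ++ [w] ∼ out(mid)` and `out(mid) ++ [b − mid] ∼ out(b)`, both by induction
      have hrec1 : WalkEquiv c n (max (hexNorm (mid - c) + 2) (hexNorm (b' - c) + 1)) c
          (outWalk c b' ++ [mid - b']) (outWalk c mid) := by
        refine ih (hexNorm (mid - c) + hexNorm (b' - c)) ?_ hmidn hb' ?_ rfl
        · rw [← hm, heq]; omega
        · convert hw using 1; rw [hmid_def]; abel
      have hrec2 : WalkEquiv c n (max (hexNorm (b - c) + 2) (hexNorm (mid - c) + 1)) c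
          (outWalk c mid ++ [b - mid]) (outWalk c b) := by
        refine ih (hexNorm (b - c) + hexNorm (mid - c)) ?_ hb hmidn ?_ rfl
        · rw [← hm]; omega
        · convert huw using 1; rw [hmid_def]; abel
      have step2 : WalkEquiv c n (max (hexNorm (b - c) + 2) (hexNorm (b' - c) + 1)) c
          (outWalk c b' ++ [w, (b - b') - w]) (outWalk c mid ++ [b - mid]) := by
        have e1 : outWalk c b' ++ [w, (b - b') - w] =
            (outWalk c b' ++ [mid - b']) ++ [b - mid] := by
          rw [List.append_assoc]; congr 1
          show [w, (b - b') - w] = [mid - b'] ++ [b - mid]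
          simp only [List.singleton_append, List.cons.injEq, and_true, hmid_def]
          constructor <;> abel
        rw [e1]
        refine (hrec1.append_right (isWalk_cons.2 ⟨by convert huw using 1; rw [hmid_def]; abel,
          isWalk_nil⟩) ?_).mono ?_
        · rw [List.sum_append, hsb', List.sum_cons, List.sum_nil, add_zero, inBall_cons, inBall_nil]
          exact ⟨by convert hmidn using 2; rw [hmid_def]; abel,
            by convert hb using 2; rw [hmid_def]; abel⟩
        · simp only [List.length_cons, List.length_nil]; omega
      exact step1.trans (step2.trans (hrec2.mono (by omega)))
    · -- (c) `b′` is an outer neighbour of `b`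
      have hbc : b' ≠ c := by
        intro h; rw [h, sub_self] at hgt; simp [hexNorm] at hgt
      obtain ⟨k, hk⟩ : ∃ k, hexNorm (b' - c) = k + 1 := Nat.exists_eq_succ_of_ne_zero (by omega)
      set u₀ := inStep (b' - c) with hu₀
      have hin₀ : hexNorm (b' - c - u₀) ≤ k :=
        hexNorm_sub_inStep_le (sub_ne_zero.2 hbc) (by rw [hk])
      have hpb : hexNorm (b' - u₀ - c) ≤ k := by
        have : b' - u₀ - c = b' - c - u₀ := by abel
        rw [this]; exact hin₀
      have hpbn : hexNorm (b' - u₀ - c) ≤ n := by omega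
      obtain ⟨hwp, hsp, hbp⟩ := outWalk_spec c (b' - u₀)
      have hlp : (outWalk c (b' - u₀)).length = hexNorm (b' - u₀ - c) := length_outWalk c _
      rw [outWalk_eq hbc, ← hu₀, List.append_assoc]
      by_cases hpred : b' - u₀ = b
      · -- `pred b′ = b`: a backtrack
        have hbb0 : b - b' = -u₀ := by rw [← hpred]; abel
        rw [hpred, hbb0]
        have e : [u₀] ++ [-u₀] = u₀ :: -u₀ :: [] := rfl
        rw [e]
        have := WalkEquiv.backtrack (c := c) (n := n)
          (L := max (hexNorm (b - c) + 2) (hexNorm (b' - c) + 1)) (g := c) (l₁ := outWalk c b)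
          (l₂ := []) (inStep_mem_unitShell (b' - c)) hwb isWalk_nil ?_ ?_
        · rwa [List.append_nil] at this
        · rw [← hu₀, inBall_append, hsb, inBall_cons, inBall_cons, inBall_nil]
          refine ⟨hbb n hb, by convert hb using 2; abel, ?_, ?_⟩
          · have : c + (b - c) + u₀ - c = b' - c := by rw [← hpred]; abel
            rw [this]; exact hb'
          · convert hb using 2; abel
        · simp only [List.length_append, List.length_cons, List.length_nil, hlb]; omega
      · -- two distinct inner neighbours `pred b′`, `b` of `b′` are adjacent: reverse triangle move
        have hnot : ¬ hexNorm (b' - c) ≤ k := by omega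
        have hin : hexNorm (b' - c - (b' - b)) ≤ k := by
          have : b' - c - (b' - b) = b - c := by abel
          rw [this]; omega
        have hne : u₀ ≠ b' - b := by intro h; exact hpred (by rw [h]; abel)
        have hadj : u₀ - (b' - b) ∈ unitShell :=
          sub_mem_unitShell_of_inner (inStep_mem_unitShell _)
            (by convert neg_mem_unitShell' hu using 1; abel) hne hnot hin₀ hin
        have hsum : u₀ + (b - b') = b - (b' - u₀) := by abel
        -- `out(pred b′) ++ [u₀, b − b′] ∼ out(pred b′) ++ [b − pred b′]` (triangle, reversed)
        have step1 : WalkEquiv c n (max (hexNorm (b - c) + 2) (hexNorm (b' - c) + 1)) c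
            (outWalk c (b' - u₀) ++ [b - (b' - u₀)]) (outWalk c (b' - u₀) ++ ([u₀] ++ [b - b'])) := by
          have e1 : outWalk c (b' - u₀) ++ [b - (b' - u₀)] =
              outWalk c (b' - u₀) ++ (b - (b' - u₀)) :: [] := rfl
          have e2 : outWalk c (b' - u₀) ++ ([u₀] ++ [b - b']) =
              outWalk c (b' - u₀) ++ u₀ :: (b - b') :: [] := rfl
          rw [e1, e2]
          refine WalkEquiv.triangle (by convert hadj using 1; abel) (inStep_mem_unitShell _) hu hsum
            hwp isWalk_nil ?_ ?_ ?_
          · rw [inBall_append, hsp, inBall_cons, inBall_nil]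
            exact ⟨hbp n hpbn, by convert hpbn using 2; abel, by convert hb using 2; abel⟩
          · rw [inBall_append, hsp, inBall_cons, inBall_cons, inBall_nil]
            exact ⟨hbp n hpbn, by convert hpbn using 2; abel, by convert hb' using 2; abel,
              by convert hb using 2; abel⟩
          · simp only [List.length_append, List.length_cons, List.length_nil, hlp]; omega
        have hrec : WalkEquiv c n (max (hexNorm (b - c) + 2) (hexNorm (b' - u₀ - c) + 1)) c
            (outWalk c (b' - u₀) ++ [b - (b' - u₀)]) (outWalk c b) := by
          refine ih (hexNorm (b - c) + hexNorm (b' - u₀ - c)) ?_ hb hpbn ?_ rfl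
          · rw [← hm]; omega
          · convert hadj using 1; abel
        exact step1.symm.trans (hrec.mono (by omega))

/-- **Local confluence, uniform bound**: for adjacent labels `b′, b` of the ball
`{hexNorm(· − c) ≤ n}`, `out(b′) ++ [b − b′] ∼ out(b)` through walks of length `≤ n + 2`.
[cite: Theil2006, §4.2 Lemma 4.6 (preprint p. 20); our combinatorial form] -/
theorem outWalk_confluence {c b b' : ℤ × ℤ} {n : ℕ} (hb : hexNorm (b - c) ≤ n)
    (hb' : hexNorm (b' - c) ≤ n) (hu : b - b' ∈ unitShell) :
    WalkEquiv c n (n + 2) c (outWalk c b' ++ [b - b']) (outWalk c b) :=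
  (outWalk_confluence' hb hb' hu).mono (by omega)

end Canonical

/-! ### Simple connectivity of hexagonal balls -/

section Main

variable {c : ℤ × ℤ} {n : ℕ} {g : ℤ × ℤ}

/-- **Every walk in the ball is move-equivalent to the canonical walk** with the same endpoints
(in to the centre, then out), through walks of length at most `length + 2n + 2`.
[cite: Theil2006, §4.2 Lemma 4.6 (preprint pp. 19–20); our combinatorial form] -/
theorem WalkEquiv.canonical {l : List (ℤ × ℤ)} (hl : IsWalk l) (hb : InBall c n g l) :
    WalkEquiv c n (l.length + 2 * n + 2) g l (revNeg (outWalk c g) ++ outWalk c (g + l.sum)) := by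
  induction l using List.reverseRecOn with
  | nil =>
    obtain ⟨hw, hs, hbg⟩ := outWalk_spec c g
    have hg : hexNorm (g - c) ≤ n := hb.start
    have hlen : (outWalk c g).length ≤ n := (length_outWalk c g).le.trans hg
    rw [List.sum_nil, add_zero]
    have h := WalkEquiv.revNeg_append_self (c := c) (n := n) (a := c) hw (hbg n hg)
    rw [hs, add_sub_cancel] at h
    exact h.symm.mono (by simp only [List.length_nil]; omega)
  | append_singleton l u ih =>
    rw [isWalk_append, isWalk_cons] at hl
    rw [inBall_append] at hb
    obtain ⟨hw, hs, hbg⟩ := outWalk_spec c g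
    have hg : hexNorm (g - c) ≤ n := hb.1.start
    have hlen : (revNeg (outWalk c g)).length ≤ n := by
      rw [length_revNeg]; exact (length_outWalk c g).le.trans hg
    set b' := g + l.sum with hb'_def
    have hbn' : hexNorm (b' - c) ≤ n := hb.2.start
    have hbn : hexNorm (b' + u - c) ≤ n := by
      have := hb.2.last
      simpa using this
    -- induction hypothesis, extended by the last step
    have h1 : WalkEquiv c n (l.length + 2 * n + 2 + [u].length) g (l ++ [u])
        (revNeg (outWalk c g) ++ outWalk c b' ++ [u]) :=
      (ih hl.1 hb.1).append_right (isWalk_cons.2 ⟨hl.2.1, isWalk_nil⟩) hb.2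
    -- confluence at the end, transported behind the inward walk from `g`
    have h2 : WalkEquiv c n (n + 2) c (outWalk c b' ++ [b' + u - b']) (outWalk c (b' + u)) :=
      outWalk_confluence hbn hbn' (by simpa using hl.2.1)
    rw [add_sub_cancel_left] at h2
    have hstart : g + (revNeg (outWalk c g)).sum = c := by rw [sum_revNeg, hs]; abel
    have h3 : WalkEquiv c n (n + 2 + (revNeg (outWalk c g)).length) g
        (revNeg (outWalk c g) ++ (outWalk c b' ++ [u]))
        (revNeg (outWalk c g) ++ outWalk c (b' + u)) := by
      refine WalkEquiv.append_left (by rwa [hstart]) (isWalk_revNeg hw) ?_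
      have := inBall_revNeg (hbg n hg)
      rwa [hs, add_sub_cancel] at this
    rw [List.sum_append, List.sum_cons, List.sum_nil, add_zero, ← add_assoc, ← hb'_def]
    rw [List.append_assoc] at h1
    refine (h1.mono ?_).trans (h3.mono ?_)
    · simp only [List.length_append, List.length_cons, List.length_nil]; omega
    · simp only [List.length_append, List.length_cons, List.length_nil]; omega

/-- **Simple connectivity of hexagonal balls (the combinatorial Lemma 4.6)**: a CLOSED lattice
walk inside the ball `{η : hexNorm(η − c) ≤ n}` reduces to the empty walk by backtrack and
triangle moves performed inside the ball, through walks of length at most `length + 2n + 2`.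
[cite: Theil2006, §4.2 Lemma 4.6 («the Burgers vector b(γ) = 0 for every discrete and simple
closed path», preprint p. 20); our combinatorial form in the flat model] -/
theorem WalkEquiv.nil_of_closed {l : List (ℤ × ℤ)} (hl : IsWalk l) (hb : InBall c n g l)
    (hsum : l.sum = 0) : WalkEquiv c n (l.length + 2 * n + 2) g l [] := by
  have h1 := WalkEquiv.canonical hl hb
  rw [hsum, add_zero] at h1
  obtain ⟨hw, hs, hbg⟩ := outWalk_spec c g
  have hlen : (outWalk c g).length ≤ n := (length_outWalk c g).le.trans hb.start
  have h2 := WalkEquiv.revNeg_append_self (c := c) (n := n) (a := c) hw (hbg n hb.start)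
  rw [hs, add_sub_cancel] at h2
  exact h1.trans (h2.mono (by omega))

/-- **Two walks in the ball with the same endpoints are move-equivalent** (path independence,
the form in which Lemma 4.6 is used for (64)), through walks of length at most
`max length + 2n + 2`. [cite: Theil2006, §4.2 Lemma 4.6 and proof of Proposition 4.8 (64)
(preprint pp. 20–21); our combinatorial form] -/
theorem WalkEquiv.of_sum_eq {l l' : List (ℤ × ℤ)} (hl : IsWalk l) (hb : InBall c n g l)
    (hl' : IsWalk l') (hb' : InBall c n g l') (hsum : l.sum = l'.sum) :
    WalkEquiv c n (max l.length l'.length + 2 * n + 2) g l l' := by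
  have h1 := WalkEquiv.canonical hl hb
  have h2 := WalkEquiv.canonical hl' hb'
  rw [hsum] at h1
  exact (h1.mono (by omega)).trans (h2.symm.mono (by omega))

/-- **Move-invariants are endpoint-determined**: a quantity attached to walks that does not change
under the two elementary moves (inside the ball, on walks of length `≤ L`) takes the same value on
any two `L`-move-equivalent walks — by `of_sum_eq`, on any two walks in the ball with the same
endpoints; the monodromy-free continuation principle behind (64).
[cite: Theil2006, §4.2 proof of Proposition 4.8 (64) with Lemma 4.6 (preprint p. 21); our
combinatorial form] -/
theorem WalkEquiv.invariant {β : Sort*} (F : List (ℤ × ℤ) → β) {L : ℕ} {l l' : List (ℤ × ℤ)}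
    (h : WalkEquiv c n L g l l')
    (hback : ∀ (l₁ l₂ : List (ℤ × ℤ)) (u : ℤ × ℤ), u ∈ unitShell → IsWalk l₁ → IsWalk l₂ →
      InBall c n g (l₁ ++ u :: -u :: l₂) → (l₁ ++ u :: -u :: l₂).length ≤ L →
      F (l₁ ++ u :: -u :: l₂) = F (l₁ ++ l₂))
    (htri : ∀ (l₁ l₂ : List (ℤ × ℤ)) (u v w : ℤ × ℤ), u ∈ unitShell → v ∈ unitShell →
      w ∈ unitShell → v + w = u → IsWalk l₁ → IsWalk l₂ → InBall c n g (l₁ ++ u :: l₂) →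
      InBall c n g (l₁ ++ v :: w :: l₂) → (l₁ ++ v :: w :: l₂).length ≤ L →
      F (l₁ ++ u :: l₂) = F (l₁ ++ v :: w :: l₂)) :
    F l = F l' := by
  induction h with
  | refl _ _ => rfl
  | symm _ ih => exact ih.symm
  | trans _ _ ih1 ih2 => exact ih1.trans ih2
  | backtrack hu h1 h2 hb hlen => exact hback _ _ _ hu h1 h2 hb hlen
  | triangle hu hv hw hvw h1 h2 hb hb' hlen => exact htri _ _ _ _ _ hu hv hw hvw h1 h2 hb hb' hlen

end Main

end Theil2006

end Literature.MathematicalPhysics.StatisticalMechanics
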